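import Summits.BirchSwinnertonDyer.Rank1Residual.Additive.CyclotomicThreeMultiplicativeReduction
import Literature.NumberTheory.EllipticCurves.QuadraticTwistKroneckerLFunctionProofs
import Literature.NumberTheory.EllipticCurves.QuadraticTwistLFunctionProofs
import Literature.NumberTheory.EllipticCurves.KodairaNeronLeFourProofs
import Literature.NumberTheory.EllipticCurves.SzpiroLocalDataProofs
import Literature.NumberTheory.EllipticCurves.TamagawaNeZeroProofs
import Literature.NumberTheory.EllipticCurves.TamagawaSubgroupProofs
import Literature.NumberTheory.DiophantineGeometry.LocalReductionFiniteBadPlacesProofs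
import Literature.NumberTheory.DiophantineGeometry.LocalReductionMinimalityProofs
import Literature.NumberTheory.DiophantineGeometry.MinimalDiscriminantNormProofs
import Mathlib.NumberTheory.RamificationInertia.Valuation
import HarnessLib

/-!
# Good places in the odd part of Milne's identity: base change (`c_𝔭 = 1`), the unit twist
# (`c = 1`) and the ramified twist (additive, `ord Δ_min = 6`, `c ≤ 4`) — row T-MIL-ODD, FILE A-3
# (seat n1011-p01 GEN 5)

HONEST FRAMING (cell `b2b-bsdres`, run/shared/lean/b2b/bsd-rank1-residual/, verbatim in every
file): the goal of the cell is to DELETE the COMBINATION-SHAPED residual classes of the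
Birch–Swinnerton-Dyer formula for ALL analytic-rank `≤ 1` elliptic curves over `ℚ` — "full BSD
formula for every rank `≤ 1` curve in class `C`" assembled STRICTLY from published theorems — so
that the rank-`≤ 1` remainder becomes exactly the CONSTRUCTION-SHAPED classes, which are TYPED
(missing-input `Prop`s), NOT attempted. This is not "finishing BSD". Sub-classes X3♯(M) / X4(M)
(additive, potentially multiplicative prime; base-change-and-descend): a RESEARCH ROUTE; they stay
CONSTRUCTION-SHAPED; nothing is booked by this file; no mark / label moved. THEOREMS ONLY: no
definition, no named fact, no `sorry`.

## What and why (row T-MIL-ODD, `cells/n1011/skel/T-MIL-ODD.md`, §1 (G))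

The local identity (L_ℓ)@p of the odd part of Milne's quadratic BSD-quotient identity (`hWR` of
`AdditivePotMult/Descent`, A65/A73; `hodd` of `bsdRHS_baseChange_quadratic_of_padicValRat`) at a
GOOD place `v` (over `ℓ`) of the globally minimal `V/ℚ`:

* `hasGoodReductionAt_baseChange_of_good`, `localTamagawaNumber_baseChange_eq_one_of_good` — `V ⊗ K`
  is good at every `𝔭 ∣ v` of any number field `K`, `c_𝔭 = 1` (`Δ(V_ℤ)` is a `𝔭`-unit);
* `hasGoodReductionAt_quadraticTwist_of_not_dvd`, `localTamagawaNumber_quadraticTwist_eq_one_of_not_dvd`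
  — for `ℓ` odd, `ℓ ∤ d`: `V^{(d)}` is good at `v` (the twist equation is integral with unit
  discriminant), `c_v(V^{(d)}) = 1`;
* `hasAdditiveReductionAt_and_ordMinimalDiscriminant_quadraticTwist_of_dvd_of_good` — for `ℓ` odd,
  `ℓ ∥ d`: the twist equation is integral and MINIMAL with `ord_v Δ = 6` (so `u_d` is an `ℓ`-unit:
  the `δ`-term vanishes), `V^{(d)}` ADDITIVE at `v` (tree `hasAdditiveReductionAt_quadraticTwist_of_dvd`),
  and `localTamagawaNumber_quadraticTwist_le_four_of_dvd_of_good`: `c_v(V^{(d)}) ≤ 4`, hence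
  `v_p(c_v(V^{(d)})) = 0` for `p ≥ 5` (`padicValNat_…_eq_zero_…_of_five_le`).

So at a good `ℓ` both sides of (L_ℓ)@p vanish for `p ≥ 5` (and for `p = 3` when `3 ∤ d`); the
`p = 3`, `3 ∣ d_K` entry needs `c ∈ {1,2,4}` (type `I₀*`) — stage B, not here; `ℓ = 2 ∣ d_K` is the
Barrios et al. 2025 row `R = I₀` (named fact in the tree), consumed by name at stage C.
HONEST LIMITS: TOOL theorems; closes no class, discharges no fact by itself; nothing about any
curve is asserted. References: Silverman *AEC* VII.1 Remark 1.1, VII.5 Prop. 5.1; *ATAEC*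
Cor. IV.9.2 (d).
-/

noncomputable section

open scoped Classical NumberField

open WeierstrassCurve NumberField IsDedekindDomain Rat.HeightOneSpectrum
  Literature.NumberTheory.EllipticCurves Literature.NumberTheory.EllipticCurves.Rank1Residual
  Literature.NumberTheory.GaloisRepresentations Field IsLocalRing
  Summit.BirchSwinnertonDyer.Rank1Residual.Additive

namespace Summit.BirchSwinnertonDyer.Rank1Residual.AdditivePotMult

/-! ## §1 Base change at a good place -/

section BaseChange

variable (V : WeierstrassCurve ℚ) [V.IsGloballyMinimal]
  {v : HeightOneSpectrum (𝓞 ℚ)} {K : Type} [Field K] [NumberField K] (𝔭 : HeightOneSpectrum (𝓞 K))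

/-- **Good reduction persists at every place above**: for `V/ℚ` globally minimal with good
reduction at `v`, `K` any number field and `𝔭 ∣ v`, `V ⊗ K` has good reduction at `𝔭` (the
`ℤ`-equation is `𝔭`-integral and `|Δ|_𝔭 = |Δ|_v^{e} = 1`). [cite: SilvermanAEC2009, VII.5 Prop. 5.1(a)] -/
theorem hasGoodReductionAt_baseChange_of_good (hgood : V.HasGoodReductionAt v)
    (h𝔭 : 𝔭.asIdeal.under (𝓞 ℚ) = v.asIdeal) : (V.baseChange K).HasGoodReductionAt 𝔭 := by
  haveI : 𝔭.asIdeal.LiesOver v.asIdeal := ⟨h𝔭.symm⟩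
  have hΔQ : v.valuation ℚ V.Δ = 1 :=
    (hasGoodReductionAt_iff_of_isMinimalAt (IsGloballyMinimal.isMinimal (W := V) v)).mp hgood
  have hint : (V.baseChange K).IsIntegralAt 𝔭 := by
    rw [← baseChange_integralModelInt_eq]
    exact isIntegralAt_baseChange_intModel (integralModelInt V) 𝔭
  refine hasGoodReductionAt_of_valuation_Δ_eq_one_holds 𝔭 (V.baseChange K) hint ?_
  have hΔ : (V.baseChange K).Δ = algebraMap ℚ K V.Δ := by rw [baseChange, map_Δ]
  have hlies := IsDedekindDomain.HeightOneSpectrum.valuation_liesOver K v 𝔭 V.Δ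
  rw [hΔQ, one_pow] at hlies
  rw [hΔ]
  first | exact hlies | exact hlies.symm

/-- **`c_𝔭(V ⊗ K) = 1` above a good place.** [cite: SilvermanATAEC1994, Cor. IV.9.2(d)] -/
theorem localTamagawaNumber_baseChange_eq_one_of_good (hgood : V.HasGoodReductionAt v)
    (h𝔭 : 𝔭.asIdeal.under (𝓞 ℚ) = v.asIdeal) :
    ((V.baseChange K).baseChange (𝔭.adicCompletion K)).localTamagawaNumber
        (𝔭.adicCompletionIntegers K) = 1 := by
  exact localTamagawaNumber_eq_one_of_hasGoodReductionAt_holds (W := V.baseChange K) 𝔭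
    (hasGoodReductionAt_baseChange_of_good V 𝔭 hgood h𝔭)

end BaseChange

/-! ## §2 The unit twist at a good odd place -/

section UnitTwist

variable (V : WeierstrassCurve ℚ) [V.IsGloballyMinimal] (v : HeightOneSpectrum (𝓞 ℚ))

/-- Integrality of the twist equation `y² = x³ + (d b₂/4)x² + (d² b₄/2)x + d³ b₆/4` at a place of
odd residue characteristic, for an integer `d` with `|d|_v ≤ 1` (bookkeeping shared by the unit
and the ramified twist). [folklore] -/
theorem isIntegralAt_quadraticTwist_of_odd (hv2 : (primesEquiv v : ℕ) ≠ 2) (d : ℤ) :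
    (V.quadraticTwist (d : ℚ)).IsIntegralAt v := by
  have hpP : (primesEquiv v : ℕ).Prime := (primesEquiv v).2
  have hpZ : Prime ((primesEquiv v : ℕ) : ℤ) := Nat.prime_iff_prime_int.mp hpP
  have hp2 : ¬ ((primesEquiv v : ℕ) : ℤ) ∣ 2 := fun h ↦
    hv2 ((Nat.prime_dvd_prime_iff_eq hpP Nat.prime_two).mp (Int.natCast_dvd_natCast.mp h))
  have hp4 : ¬ ((primesEquiv v : ℕ) : ℤ) ∣ 4 := fun h ↦
    (hpZ.dvd_or_dvd (show ((primesEquiv v : ℕ) : ℤ) ∣ 2 * 2 by norm_num; exact h)).elim hp2 hp2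
  set M : WeierstrassCurve ℤ := integralModelInt V with hM
  have hVM : M.map (Int.castRingHom ℚ) = V := map_integralModelInt V
  have hVb₂ : V.b₂ = (M.b₂ : ℚ) := by rw [← congrArg WeierstrassCurve.b₂ hVM, map_b₂, eq_intCast]
  have hVb₄ : V.b₄ = (M.b₄ : ℚ) := by rw [← congrArg WeierstrassCurve.b₄ hVM, map_b₄, eq_intCast]
  have hVb₆ : V.b₆ = (M.b₆ : ℚ) := by rw [← congrArg WeierstrassCurve.b₆ hVM, map_b₆, eq_intCast]
  have hv4 : v.valuation ℚ (4 : ℚ) = 1 := by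
    have h := valuation_ringOfIntegers_intCast_eq_one v (n := 4) (by exact_mod_cast hp4)
    simpa using h
  have hv2' : v.valuation ℚ (2 : ℚ) = 1 := by
    have h := valuation_ringOfIntegers_intCast_eq_one v (n := 2) (by exact_mod_cast hp2)
    simpa using h
  have hvD : v.valuation ℚ (d : ℚ) ≤ 1 := valuation_ringOfIntegers_intCast_le_one v d
  have hvb₂ : v.valuation ℚ V.b₂ ≤ 1 := hVb₂ ▸ valuation_ringOfIntegers_intCast_le_one v _
  have hvb₄ : v.valuation ℚ V.b₄ ≤ 1 := hVb₄ ▸ valuation_ringOfIntegers_intCast_le_one v _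
  have hvb₆ : v.valuation ℚ V.b₆ ≤ 1 := hVb₆ ▸ valuation_ringOfIntegers_intCast_le_one v _
  refine (V.quadraticTwist (d : ℚ)).isIntegralAt_of_valuation_le_one v ?_ ?_ ?_ ?_ ?_
  · simp
  · simp only [quadraticTwist_a₂, map_div₀, map_mul, hv4, div_one]
    exact mul_le_one' hvD hvb₂
  · simp
  · simp only [quadraticTwist_a₄, map_div₀, map_mul, map_pow, hv2', div_one]
    exact mul_le_one' (pow_le_one' hvD 2) hvb₄
  · simp only [quadraticTwist_a₆, map_div₀, map_mul, map_pow, hv4, div_one]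
    exact mul_le_one' (pow_le_one' hvD 3) hvb₆

/-- **The unit twist of a good odd place is good, on a minimal equation**: for `V/ℚ` globally
minimal good at `v` (over `ℓ` odd) and `ℓ ∤ d`, the twist equation `V^{(d)}` is `v`-integral with
`|Δ|_v = |d|⁶|Δ(V)| = 1`, hence minimal with good reduction, and `c_v(V^{(d)}) = 1`.
[cite: SilvermanAEC2009, VII.1 Remark 1.1 and VII.5 Prop. 5.1(a)] -/
theorem hasGoodReductionAt_quadraticTwist_of_not_dvd (hv2 : (primesEquiv v : ℕ) ≠ 2) {d : ℤ}
    (hd : ¬ ((primesEquiv v : ℕ) : ℤ) ∣ d) (hgood : V.HasGoodReductionAt v) :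
    (V.quadraticTwist (d : ℚ)).IsMinimalAt v ∧ (V.quadraticTwist (d : ℚ)).HasGoodReductionAt v := by
  have hint := isIntegralAt_quadraticTwist_of_odd V v hv2 d
  have hΔV : v.valuation ℚ V.Δ = 1 :=
    (hasGoodReductionAt_iff_of_isMinimalAt (IsGloballyMinimal.isMinimal (W := V) v)).mp hgood
  have hdv : v.valuation ℚ (d : ℚ) = 1 := valuation_ringOfIntegers_intCast_eq_one v hd
  have hΔ : v.valuation ℚ (V.quadraticTwist (d : ℚ)).Δ = 1 := by
    rw [quadraticTwist_Δ, map_mul, map_pow, hdv, one_pow, one_mul, hΔV]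
  have hmin : (V.quadraticTwist (d : ℚ)).IsMinimalAt v :=
    isMinimalAt_of_lt_valuation_Δ_holds hint (by
      rw [hΔ, ← WithZero.exp_zero]; exact WithZero.exp_lt_exp.mpr (by norm_num))
  exact ⟨hmin, hasGoodReductionAt_of_valuation_Δ_eq_one_holds v _ hint hΔ⟩

/-- **`c_v(V^{(d)}) = 1` at the unit twist of a good odd place.** [cite: SilvermanATAEC1994, Cor. IV.9.2(d)] -/
theorem localTamagawaNumber_quadraticTwist_eq_one_of_not_dvd (hv2 : (primesEquiv v : ℕ) ≠ 2)
    {d : ℤ} (hd : ¬ ((primesEquiv v : ℕ) : ℤ) ∣ d) (hgood : V.HasGoodReductionAt v) :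
    (((V.quadraticTwist (d : ℚ)).baseChange (v.adicCompletion ℚ)).localTamagawaNumber
        (v.adicCompletionIntegers ℚ)) = 1 := by
  exact localTamagawaNumber_eq_one_of_hasGoodReductionAt_holds (W := V.quadraticTwist (d : ℚ)) v
    (hasGoodReductionAt_quadraticTwist_of_not_dvd V v hv2 hd hgood).2

end UnitTwist

/-! ## §3 The ramified twist at a good odd place -/

section RamifiedTwist

variable (V : WeierstrassCurve ℚ) [V.IsElliptic] [V.IsGloballyMinimal] (v : HeightOneSpectrum (𝓞 ℚ))

/-- **The ramified twist of a good odd place: minimal equation, additive, `ord Δ_min = 6`.** For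
`V/ℚ` globally minimal good at `v` (over `ℓ` odd) and `ℓ ∥ d`: the twist equation is `v`-integral
with `ord_v Δ = 6 < 12`, hence MINIMAL (so a globally minimal model `Cd • V^{(d)}` has
`ord_ℓ(Cd.u) = 0`), and `V^{(d)}` is ADDITIVE at `v` (tree `hasAdditiveReductionAt_quadraticTwist_of_dvd`)
with `ord_v Δ_min(V^{(d)}) = 6` (Kodaira type `I₀*`; the type is not asserted here).
[cite: SilvermanAEC2009, VII.1 Remark 1.1 and VII.5 Prop. 5.1(c)] -/
theorem hasAdditiveReductionAt_and_ordMinimalDiscriminant_quadraticTwist_of_dvd_of_good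
    (hv2 : (primesEquiv v : ℕ) ≠ 2) {d : ℤ} (h1 : ((primesEquiv v : ℕ) : ℤ) ∣ d)
    (h2 : ¬ ((primesEquiv v : ℕ) : ℤ) ^ 2 ∣ d) (hgood : V.HasGoodReductionAt v) :
    (V.quadraticTwist (d : ℚ)).IsMinimalAt v ∧ (V.quadraticTwist (d : ℚ)).HasAdditiveReductionAt v ∧
      (V.quadraticTwist (d : ℚ)).ordMinimalDiscriminant v = 6 := by
  have hd0 : d ≠ 0 := by rintro rfl; exact h2 (dvd_zero _)
  have hdq : (d : ℚ) ≠ 0 := by exact_mod_cast hd0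
  haveI := V.isElliptic_quadraticTwist hdq
  have hint := isIntegralAt_quadraticTwist_of_odd V v hv2 d
  have hΔV : v.valuation ℚ V.Δ = 1 :=
    (hasGoodReductionAt_iff_of_isMinimalAt (IsGloballyMinimal.isMinimal (W := V) v)).mp hgood
  have hvD : v.valuation ℚ (d : ℚ) = WithZero.exp (-1 : ℤ) :=
    valuation_ringOfIntegers_intCast_eq_exp_neg_one v h1 h2
  have hΔ : v.valuation ℚ (V.quadraticTwist (d : ℚ)).Δ = WithZero.exp (-6 : ℤ) := by
    rw [quadraticTwist_Δ, map_mul, map_pow, hvD, hΔV, mul_one, ← WithZero.exp_nsmul]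
    norm_num
  have hmin : (V.quadraticTwist (d : ℚ)).IsMinimalAt v :=
    isMinimalAt_of_lt_valuation_Δ_holds hint (by rw [hΔ]; exact WithZero.exp_lt_exp.mpr (by norm_num))
  refine ⟨hmin, hasAdditiveReductionAt_quadraticTwist_of_dvd V v hv2 hd0 h1 h2 hgood, ?_⟩
  have h := valuation_Δ_eq_of_isMinimalAt_holds v (V.quadraticTwist (d : ℚ)) hmin
  rw [hΔ, WithZero.exp_inj, neg_inj] at h
  exact_mod_cast h.symm

/-- **`c_v(V^{(d)}) ≤ 4` at the ramified twist of a good odd place** (additive; Kodaira–Néron bound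
at a non-split place, tree `index_goodReductionSubgroup_le_four_holds`), and hence
`v_p(c_v(V^{(d)})) = 0` for every prime `p ≥ 5` (next theorem). The `p = 3` refinement
`c ∈ {1, 2, 4}` (type `I₀*`) is NOT proved here — stage-B binder.
[cite: SilvermanATAEC1994, Cor. IV.9.2(d) (PDF p. 340)] -/
theorem localTamagawaNumber_quadraticTwist_le_four_of_dvd_of_good (hv2 : (primesEquiv v : ℕ) ≠ 2)
    {d : ℤ} (h1 : ((primesEquiv v : ℕ) : ℤ) ∣ d) (h2 : ¬ ((primesEquiv v : ℕ) : ℤ) ^ 2 ∣ d)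
    (hgood : V.HasGoodReductionAt v) :
    (((V.quadraticTwist (d : ℚ)).baseChange (v.adicCompletion ℚ)).localTamagawaNumber
        (v.adicCompletionIntegers ℚ)) ≤ 4 := by
  have hd0 : d ≠ 0 := by rintro rfl; exact h2 (dvd_zero _)
  have hdq : (d : ℚ) ≠ 0 := by exact_mod_cast hd0
  haveI := V.isElliptic_quadraticTwist hdq
  haveI : Finite (ResidueField (v.adicCompletionIntegers ℚ)) := Nat.finite_of_card_ne_zero
    (by rw [WeierstrassCurve.natCard_residueField_adicCompletionIntegers v]; exact (primesEquiv v).2.ne_zero)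
  haveI : PerfectField (ResidueField (v.adicCompletionIntegers ℚ)) := PerfectField.ofFinite
  have hadd := hasAdditiveReductionAt_quadraticTwist_of_dvd V v hv2 hd0 h1 h2 hgood
  haveI : ((V.quadraticTwist (d : ℚ)).localMinimalModel v).IsElliptic :=
    (V.quadraticTwist (d : ℚ)).isElliptic_localMinimalModel v
  have hns : ¬ ((V.quadraticTwist (d : ℚ)).localMinimalModel v).HasSplitMultiplicativeReduction
      (v.adicCompletionIntegers ℚ) := fun h =>
    (hadd.not_hasMultiplicativeReductionAt) h.toHasMultiplicativeReduction
  exact (((V.quadraticTwist (d : ℚ)).localMinimalModel v).index_goodReductionSubgroup_le_four_holds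
    (v.adicCompletionIntegers ℚ) hns).2

/-- **`v_p(c_v(V^{(d)})) = 0` for `p ≥ 5` at the ramified twist of a good odd place.**
[cite: SilvermanATAEC1994, Cor. IV.9.2(d) (PDF p. 340)] -/
theorem padicValNat_localTamagawaNumber_quadraticTwist_eq_zero_of_dvd_of_good_of_five_le
    (hv2 : (primesEquiv v : ℕ) ≠ 2) {d : ℤ} (h1 : ((primesEquiv v : ℕ) : ℤ) ∣ d)
    (h2 : ¬ ((primesEquiv v : ℕ) : ℤ) ^ 2 ∣ d) (hgood : V.HasGoodReductionAt v)
    (p : ℕ) [Fact p.Prime] (h5 : 5 ≤ p) :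
    padicValNat p (((V.quadraticTwist (d : ℚ)).baseChange (v.adicCompletion ℚ)).localTamagawaNumber
        (v.adicCompletionIntegers ℚ)) = 0 := by
  have hle := localTamagawaNumber_quadraticTwist_le_four_of_dvd_of_good V v hv2 h1 h2 hgood
  refine padicValNat.eq_zero_of_not_dvd fun hdvd => ?_
  have hd0 : d ≠ 0 := by rintro rfl; exact h2 (dvd_zero _)
  have hdq : (d : ℚ) ≠ 0 := by exact_mod_cast hd0
  haveI := V.isElliptic_quadraticTwist hdq
  haveI : ((V.quadraticTwist (d : ℚ)).baseChange (v.adicCompletion ℚ)).IsElliptic := by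
    rw [baseChange]; infer_instance
  have hpos : 0 < ((V.quadraticTwist (d : ℚ)).baseChange (v.adicCompletion ℚ)).localTamagawaNumber
      (v.adicCompletionIntegers ℚ) :=
    Nat.pos_of_ne_zero (localTamagawaNumber_ne_zero_holds (v.adicCompletionIntegers ℚ) _)
  have := Nat.le_of_dvd hpos hdvd
  omega

end RamifiedTwist

end Summit.BirchSwinnertonDyer.Rank1Residual.AdditivePotMult

end
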